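import Summits.CriticalPhenomena.PercolationContinuityZ3.Theorems.PercNearOneGluingNoHeavyLowerTailSeqExchange
import Summits.CriticalPhenomena.PercolationContinuityZ3.Theorems.PercNearOneGluingNoHeavyLowerTailUpsetExchangeAny
import Summits.CriticalPhenomena.PercolationContinuityZ3.Theorems.PercNearOneGluingNoHeavyLowerTailBlockQ9OneDangerousPort
import HarnessLib

/-!
# `NoHeavyLowerTail` (stmt-CriticalPhenomena-4575) — the ANCHORED PIECE of the θ-mixture certificate for
# Kozma–Nitzan's Question 9 on a glued one-layer block (tools for `…BlockQ9TwoDangerous.lean`)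

Support file (hull-port / coupling seat `prim-hp-1` gen 8; `--supports stmt-CriticalPhenomena-4575`).
No definitions, no named facts, no sorries.  Memo `run/shared/lean/prim/prim-hp-1/HULLPORT-COUPLING.md` §50(d).

Setting (`Fin n`, weights `w` = the UNGLUED ranking graph, e.g. the split graph of a depth-two observer):
a block `O` (glued: `glue_O w := fun e => if (∀ x ∈ e, x ∈ O) ∧ ¬ e.IsDiag then 1 else w e`), relays `A` disjoint
from `O`, one-layer (`w s(x,y) = 0` for `x ∈ O`, `y ∉ O ∪ A`), target `b ∉ O`, anchor relay `a ∉ O`,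
`kill_O w := fun e => if (∃ x ∈ e, x ∈ O) then 0 else w e` (the block deleted).  Question 9 for the block is
`BQ : μ_{glue_O w}(a ↔ b, O ↔ A) ≤ μ_{glue_O w}(O ↔ b)`.

Known leaves: every port dominates `a` in `kill_O w` (`BlockQ9.blockThm4_witness`, KN Thm 4); all ports but ONE
pair `e` dominate and `a ≤ v_e` in `w` (`BlockQ9.blockQ9_oneDangerousPort`; one relay with several pairs:
`BlockQ9.blockQ9_oneDangerousRelay`); two dangerous pairs with NESTED domination (`BlockQ9.blockQ9_twoDangerousPorts`).

This file: `BlockQ9.piece` — the ANCHORED PIECE: for a boundary pair `e = s(p,s₀)` forced open and another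
non-internal pair `e'` re-weighted to `r`, if `a ≤ p` in the re-weighted UNGLUED graph `w[e ↦ 1, e' ↦ r]` then the
`r`-mixture of the two pinned values `μ_{glue[e↦1,e'↦t]}(a ↔ b) − μ_{glue[e↦1,e'↦t]}(O ↔ b)` (`t = 0,1`) is `≤ 0`
(`UpsetExchange.upsetExchange_any_block` applied to the re-weighted graph); plus the bookkeeping lemmas
`glue_update_of_not_internal`, `kill_update_of_meets`, `real_inter_mem_of_weight_one`, and the
arithmetic `exists_theta` (choice of the mixture parameter from the four covering inequalities).
The theorem `BlockQ9.blockQ9_twoDangerous` (two dangerous port pairs) is in `…BlockQ9TwoDangerous.lean`.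
[cite: KozmaNitzan2024, Lemma 5 (p. 13)]
-/

namespace Summit.CriticalPhenomena.PercolationContinuityZ3.Theorems

open MeasureTheory Set
open Literature.Probability.LatticeModels
open Literature.Probability.Percolation

noncomputable section
open Classical

namespace BlockQ9

variable {n : ℕ}

/-- Gluing commutes with re-weighting a pair that is not internal to the block. [folklore] -/
theorem glue_update_of_not_internal (w : Sym2 (Fin n) → unitInterval) (O : Finset (Fin n)) (e : Sym2 (Fin n))
    (he : ¬ ((∀ x ∈ e, x ∈ O) ∧ ¬ e.IsDiag)) (t : unitInterval) :
    (fun f : Sym2 (Fin n) => if (∀ x ∈ f, x ∈ O) ∧ ¬ f.IsDiag then (1 : unitInterval) else Function.update w e t f) =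
      Function.update (fun f : Sym2 (Fin n) => if (∀ x ∈ f, x ∈ O) ∧ ¬ f.IsDiag then (1 : unitInterval) else w f) e t := by
  funext f
  by_cases hf : f = e
  · subst hf
    rw [if_neg he, Function.update_self, Function.update_self]
  · rw [Function.update_of_ne hf, Function.update_of_ne hf]

/-- Deleting the block commutes with (ignores) re-weighting a pair that meets the block. [folklore] -/
theorem kill_update_of_meets (w : Sym2 (Fin n) → unitInterval) (O : Finset (Fin n)) (e : Sym2 (Fin n))
    (he : ∃ x ∈ e, x ∈ O) (t : unitInterval) :
    (fun f : Sym2 (Fin n) => if (∃ x ∈ f, x ∈ O) then (0 : unitInterval) else Function.update w e t f) =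
      fun f : Sym2 (Fin n) => if (∃ x ∈ f, x ∈ O) then (0 : unitInterval) else w f := by
  funext f
  by_cases hf : f = e
  · subst hf
    rw [if_pos he, if_pos he]
  · rw [Function.update_of_ne hf]

/-- If the pair `e` has weight `1`, intersecting with `{e open}` does not change probabilities. [folklore] -/
theorem real_inter_mem_of_weight_one (u : Sym2 (Fin n) → unitInterval) (e : Sym2 (Fin n)) (he : u e = 1)
    (Y : Set (BondConfig (Fin n))) :
    (prodBernoulli u).real (Y ∩ {ω | e ∈ ω}) = (prodBernoulli u).real Y := by
  rw [goodStepEI_real_inter_open_eq u e Y]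
  have hu : Function.update u e 1 = u := by rw [← he, Function.update_eq_self]
  rw [hu, he]
  simp

/-- **Anchored piece.**  Block `O`, a boundary pair `e = s(p, s₀)` (`s₀ ∈ O`, `p ∉ O`), another non-internal pair
`e' ≠ e`, a weight `r`; `W := w[e ↦ 1, e' ↦ r]` the anchored unglued weights and `G_t := (glue_O w)[e ↦ 1, e' ↦ t]`.
If `μ_W(a ↔ b) ≤ μ_W(p ↔ b)` then
`(1 − r)·(μ_{G_0}(a ↔ b) − μ_{G_0}(O ↔ b)) + r·(μ_{G_1}(a ↔ b) − μ_{G_1}(O ↔ b)) ≤ 0`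
— the up-set exchange with arbitrary internal weights (`UpsetExchange.upsetExchange_any_block`) applied to `W`.
[cite: KozmaNitzan2024, Lemma 5 (p. 13)] -/
theorem piece (w : Sym2 (Fin n) → unitInterval) (O : Finset (Fin n)) (a b p s₀ : Fin n) (e' : Sym2 (Fin n))
    (r : unitInterval) (hpO : p ∉ O) (hs₀ : s₀ ∈ O) (he' : ¬ ((∀ x ∈ e', x ∈ O) ∧ ¬ e'.IsDiag))
    (hne : e' ≠ s(p, s₀))
    (hanchor : (prodBernoulli (Function.update (Function.update w s(p, s₀) 1) e' r)).real (openConn a b) ≤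
      (prodBernoulli (Function.update (Function.update w s(p, s₀) 1) e' r)).real (openConn p b)) :
    (1 - (r : ℝ)) *
        ((prodBernoulli (Function.update (Function.update
            (fun f : Sym2 (Fin n) => if (∀ x ∈ f, x ∈ O) ∧ ¬ f.IsDiag then (1 : unitInterval) else w f)
            s(p, s₀) 1) e' 0)).real (openConn a b) -
          (prodBernoulli (Function.update (Function.update
            (fun f : Sym2 (Fin n) => if (∀ x ∈ f, x ∈ O) ∧ ¬ f.IsDiag then (1 : unitInterval) else w f)
            s(p, s₀) 1) e' 0)).real (⋃ o ∈ O, openConn o b)) +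
      (r : ℝ) *
        ((prodBernoulli (Function.update (Function.update
            (fun f : Sym2 (Fin n) => if (∀ x ∈ f, x ∈ O) ∧ ¬ f.IsDiag then (1 : unitInterval) else w f)
            s(p, s₀) 1) e' 1)).real (openConn a b) -
          (prodBernoulli (Function.update (Function.update
            (fun f : Sym2 (Fin n) => if (∀ x ∈ f, x ∈ O) ∧ ¬ f.IsDiag then (1 : unitInterval) else w f)
            s(p, s₀) 1) e' 1)).real (⋃ o ∈ O, openConn o b)) ≤ 0 := by
  set e : Sym2 (Fin n) := s(p, s₀) with hedef
  set W : Sym2 (Fin n) → unitInterval := Function.update (Function.update w e 1) e' r with hW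
  set g : Sym2 (Fin n) → unitInterval :=
    fun f : Sym2 (Fin n) => if (∀ x ∈ f, x ∈ O) ∧ ¬ f.IsDiag then (1 : unitInterval) else w f with hg
  set G : Sym2 (Fin n) → unitInterval := Function.update (Function.update g e 1) e' r with hG
  have hps₀ : p ≠ s₀ := fun h => hpO (h ▸ hs₀)
  have he_nint : ¬ ((∀ x ∈ e, x ∈ O) ∧ ¬ e.IsDiag) := fun h => hpO (h.1 p (Sym2.mem_mk_left p s₀))
  -- glue of the anchored weights
  have hglue : (fun f : Sym2 (Fin n) => if (∀ x ∈ f, x ∈ O) ∧ ¬ f.IsDiag then (1 : unitInterval) else W f) = G := by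
    rw [hW, glue_update_of_not_internal _ O e' he', glue_update_of_not_internal _ O e he_nint]
  -- the up-set exchange for `C = {e}`
  have hC : ∀ f ∈ ({e} : Finset (Sym2 (Fin n))), ¬ f.IsDiag ∧ ∃ x ∈ f, x ∈ O := by
    intro f hf
    rw [Finset.mem_singleton] at hf
    subst hf
    exact ⟨by rw [hedef, Sym2.mk_isDiag_iff]; exact hps₀, s₀, Sym2.mem_mk_right p s₀, hs₀⟩
  have hsv : s(s₀, p) ∈ ({e} : Finset (Sym2 (Fin n))) := by
    rw [Finset.mem_singleton, hedef, Sym2.eq_swap]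
  have key := UpsetExchange.upsetExchange_any_block W O a b p s₀ hpO hs₀ {e} hC hsv hanchor
  rw [hglue] at key
  have hset : {ω : BondConfig (Fin n) | (↑({e} : Finset (Sym2 (Fin n))) : Set (Sym2 (Fin n))) ⊆ ω} =
      {ω | e ∈ ω} := by
    ext ω; simp
  rw [hset] at key
  -- `G e = 1`, so the intersections with `{e open}` can be dropped
  have hGe : G e = 1 := by
    rw [hG, Function.update_of_ne hne.symm, Function.update_self]
  rw [real_inter_mem_of_weight_one G e hGe, real_inter_mem_of_weight_one G e hGe] at key
  -- `s₀ ↔ b` implies `O ↔ b`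
  have hmono : (prodBernoulli G).real (openConn s₀ b) ≤ (prodBernoulli G).real (⋃ o ∈ O, openConn o b) :=
    measureReal_mono (fun ω hω => Set.mem_iUnion₂.2 ⟨s₀, hs₀, hω⟩) (measure_ne_top _ _)
  -- decompose along `e'`
  have hGe' : (G e' : ℝ) = r := by rw [hG, Function.update_self]
  have hd₁ := stub_oneBondDecomp_k15 n G e' (openConn a b)
  have hd₂ := stub_oneBondDecomp_k15 n G e' (⋃ o ∈ O, openConn o b)
  have h0 : Function.update G e' 0 = Function.update (Function.update g e 1) e' 0 := by
    rw [hG, Function.update_idem]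
  have h1 : Function.update G e' 1 = Function.update (Function.update g e 1) e' 1 := by
    rw [hG, Function.update_idem]
  rw [hGe', h0, h1] at hd₁ hd₂
  linarith [key.trans hmono]

/-- Choice of the mixture parameter: from `α₁ ≤ β₁`, `α₂ ≤ β₂`, `α₁ + α₂ ≤ β₁`, `α₁ + α₂ ≤ β₂` there is
`θ ∈ [0,1]` with `α₁ ≤ θ β₁` and `α₂ ≤ (1 − θ) β₂`. [folklore] -/
theorem exists_theta {α₁ β₁ α₂ β₂ : ℝ} (h₁ : α₁ ≤ β₁) (h₂ : α₂ ≤ β₂) (h₁₂ : α₁ + α₂ ≤ β₁)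
    (h₂₁ : α₁ + α₂ ≤ β₂) : ∃ θ : ℝ, 0 ≤ θ ∧ θ ≤ 1 ∧ α₁ ≤ θ * β₁ ∧ α₂ ≤ (1 - θ) * β₂ := by
  by_cases ha₁ : α₁ ≤ 0
  · exact ⟨0, le_rfl, zero_le_one, by linarith, by linarith⟩
  by_cases ha₂ : α₂ ≤ 0
  · exact ⟨1, zero_le_one, le_rfl, by linarith, by linarith⟩
  push Not at ha₁ ha₂
  have hs : 0 < α₁ + α₂ := by linarith
  refine ⟨α₁ / (α₁ + α₂), div_nonneg ha₁.le hs.le, (div_le_one hs).2 (by linarith), ?_, ?_⟩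
  · rw [div_mul_eq_mul_div, le_div_iff₀ hs]
    nlinarith
  · have : 1 - α₁ / (α₁ + α₂) = α₂ / (α₁ + α₂) := by field_simp; ring
    rw [this, div_mul_eq_mul_div, le_div_iff₀ hs]
    nlinarith

end BlockQ9

end

end Summit.CriticalPhenomena.PercolationContinuityZ3.Theorems
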